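import Mathlib
import HarnessLib

/-!
# Route `LeeYangFibres`, crux `AbsoluteUpgrade` (stmt-Parity-14116), line `dip-margin-rate-exchange`:
# compactness constants for `Γ(1 ± z)` on a rectangle off the real axis
# (helper for the stub `pencil_chainZero`)

Helper file for the registered stub `pencil_chainZero : PencilChainZero` (pure complex analysis about
`Γ`; no number theory).  On the compact rectangle `Y = [−A−1, 3] × [1/2, 3/2]` the functions `Γ(1+z)`,
`Γ(1−z)` and the ratio `R(z) = Γ(1−z)/Γ(1+z)` are holomorphic (the poles of `Γ` are real while
`Im (1 ± z) ≠ 0`) and zero-free, so ONE constant `C ≥ 1` bounds `|Γ(1±z)|^{±1}` and `|R(z)|^{±1}` on `Y`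
and is a Lipschitz constant for `R` on the convex set `Y` (mean value inequality with `sup_Y |R'|`, the
derivative `R'` being holomorphic, hence continuous, on the open upper half plane).
Main theorem: `pencilChainZero_compactBounds` (registered helper of the line).
-/

noncomputable section

namespace Summit.Parity.GeneralizedHardyLittlewood.Cruxes.AbsoluteUpgrade.DipMarginRateExchange

open Complex Set Metric

/-- In the open upper half plane `1 + z` and `1 - z` avoid the poles `0, -1, -2, …` of `Γ`. -/
theorem pencilChainZero_ne_pole {z : ℂ} (hz : 0 < z.im) (m : ℕ) :
    1 + z ≠ -(m : ℂ) ∧ 1 - z ≠ -(m : ℂ) := by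
  refine ⟨fun h => ?_, fun h => ?_⟩
  · have h1 := congrArg Complex.im h
    simp only [add_im, one_im, neg_im, natCast_im, neg_zero, zero_add] at h1
    exact hz.ne' h1
  · have h1 := congrArg Complex.im h
    simp only [sub_im, one_im, neg_im, natCast_im, neg_zero, zero_sub, neg_eq_zero] at h1
    exact hz.ne' h1

/-- On the open upper half plane `Γ(1 + z) ≠ 0` and `Γ(1 - z) ≠ 0`. -/
theorem pencilChainZero_Gamma_ne_zero {z : ℂ} (hz : 0 < z.im) :
    Gamma (1 + z) ≠ 0 ∧ Gamma (1 - z) ≠ 0 :=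
  ⟨Complex.Gamma_ne_zero fun m => (pencilChainZero_ne_pole hz m).1,
    Complex.Gamma_ne_zero fun m => (pencilChainZero_ne_pole hz m).2⟩

/-- `z ↦ Γ(1+z)`, `z ↦ Γ(1−z)` and `R(z) = Γ(1−z)/Γ(1+z)` are holomorphic on the open upper half
plane. -/
theorem pencilChainZero_differentiableOn :
    DifferentiableOn ℂ (fun z : ℂ => Gamma (1 + z)) {z : ℂ | 0 < z.im} ∧
      DifferentiableOn ℂ (fun z : ℂ => Gamma (1 - z)) {z : ℂ | 0 < z.im} ∧
      DifferentiableOn ℂ (fun z : ℂ => Gamma (1 - z) / Gamma (1 + z)) {z : ℂ | 0 < z.im} := by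
  have hp : DifferentiableOn ℂ (fun z : ℂ => Gamma (1 + z)) {z : ℂ | 0 < z.im} := by
    intro z hz
    have h := Complex.differentiableAt_Gamma (1 + z) fun m => (pencilChainZero_ne_pole hz m).1
    exact (h.comp z ((differentiableAt_const _).add differentiableAt_id)).differentiableWithinAt
  have hm : DifferentiableOn ℂ (fun z : ℂ => Gamma (1 - z)) {z : ℂ | 0 < z.im} := by
    intro z hz
    have h := Complex.differentiableAt_Gamma (1 - z) fun m => (pencilChainZero_ne_pole hz m).2
    exact (h.comp z ((differentiableAt_const _).sub differentiableAt_id)).differentiableWithinAt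
  exact ⟨hp, hm, hm.fun_div hp fun z hz => (pencilChainZero_Gamma_ne_zero hz).1⟩

/-- **Compactness constants** (registered helper for `pencil_chainZero`).  For every real `A` there is
ONE constant `C ≥ 1` such that on the rectangle `Y = [−A−1, 3] × [1/2, 3/2]`:
`C⁻¹ ≤ |Γ(1∓z)| ≤ C`, `C⁻¹ ≤ |R(z)| ≤ C` for `R(z) = Γ(1−z)/Γ(1+z)`, and `|R(w) − R(z)| ≤ C|w − z|` for
`z, w ∈ Y`.  Proof: `Γ(1±z)` and `R` are holomorphic and zero-free on the open upper half plane, which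
contains the compact convex `Y`; take the maxima of the seven continuous functions `|Γ(1±z)|^{±1}`,
`|R|^{±1}`, `|R'|` on `Y` and the mean value inequality on the convex set `Y`. -/
theorem pencilChainZero_compactBounds : ∀ A : ℝ, ∃ C : ℝ, 1 ≤ C ∧ ∀ z ∈ Set.Icc (-A - 1) 3 ×ℂ Set.Icc (1 / 2) (3 / 2), (C⁻¹ ≤ ‖Complex.Gamma (1 - z)‖ ∧ ‖Complex.Gamma (1 - z)‖ ≤ C ∧ C⁻¹ ≤ ‖Complex.Gamma (1 + z)‖ ∧ ‖Complex.Gamma (1 + z)‖ ≤ C) ∧ C⁻¹ ≤ ‖Complex.Gamma (1 - z) / Complex.Gamma (1 + z)‖ ∧ ‖Complex.Gamma (1 - z) / Complex.Gamma (1 + z)‖ ≤ C ∧ ∀ w ∈ Set.Icc (-A - 1) 3 ×ℂ Set.Icc (1 / 2) (3 / 2), ‖Complex.Gamma (1 - w) / Complex.Gamma (1 + w) - Complex.Gamma (1 - z) / Complex.Gamma (1 + z)‖ ≤ C * ‖w - z‖ := by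
  intro A
  set K : Set ℂ := Set.Icc (-A - 1) 3 ×ℂ Set.Icc (1 / 2) (3 / 2) with hK
  have hUo : IsOpen {z : ℂ | 0 < z.im} := isOpen_lt continuous_const Complex.continuous_im
  have hKU : K ⊆ {z : ℂ | 0 < z.im} := fun z hz => by
    have h := (mem_reProdIm.1 hz).2.1
    show (0 : ℝ) < z.im
    linarith
  have hKc : IsCompact K := isCompact_Icc.reProdIm isCompact_Icc
  have hKconv : Convex ℝ K := convexHull_eq_self.1 (by
    rw [hK, Complex.convexHull_reProdIm, (convex_Icc _ _).convexHull_eq, (convex_Icc _ _).convexHull_eq])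
  obtain ⟨hp, hm, hR⟩ := pencilChainZero_differentiableOn
  have hp0 : ∀ z ∈ K, (fun z : ℂ => Gamma (1 + z)) z ≠ 0 := fun z hz =>
    (pencilChainZero_Gamma_ne_zero (hKU hz)).1
  have hm0 : ∀ z ∈ K, (fun z : ℂ => Gamma (1 - z)) z ≠ 0 := fun z hz =>
    (pencilChainZero_Gamma_ne_zero (hKU hz)).2
  have hR0 : ∀ z ∈ K, (fun z : ℂ => Gamma (1 - z) / Gamma (1 + z)) z ≠ 0 := fun z hz =>
    div_ne_zero (hm0 z hz) (hp0 z hz)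
  have cp : ContinuousOn (fun z : ℂ => Gamma (1 + z)) K := hp.continuousOn.mono hKU
  have cm : ContinuousOn (fun z : ℂ => Gamma (1 - z)) K := hm.continuousOn.mono hKU
  have cR : ContinuousOn (fun z : ℂ => Gamma (1 - z) / Gamma (1 + z)) K := hR.continuousOn.mono hKU
  have cdR : ContinuousOn (deriv fun z : ℂ => Gamma (1 - z) / Gamma (1 + z)) K :=
    (hR.analyticOnNhd hUo).deriv.continuousOn.mono hKU
  obtain ⟨C₁, hC₁⟩ := hKc.exists_bound_of_continuousOn cp
  obtain ⟨C₂, hC₂⟩ := hKc.exists_bound_of_continuousOn (cp.inv₀ hp0)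
  obtain ⟨C₃, hC₃⟩ := hKc.exists_bound_of_continuousOn cm
  obtain ⟨C₄, hC₄⟩ := hKc.exists_bound_of_continuousOn (cm.inv₀ hm0)
  obtain ⟨C₅, hC₅⟩ := hKc.exists_bound_of_continuousOn cR
  obtain ⟨C₆, hC₆⟩ := hKc.exists_bound_of_continuousOn (cR.inv₀ hR0)
  obtain ⟨C₇, hC₇⟩ := hKc.exists_bound_of_continuousOn cdR
  set C : ℝ := max 1 (max C₁ (max C₂ (max C₃ (max C₄ (max C₅ (max C₆ C₇)))))) with hC
  have h1 : 1 ≤ C := le_max_left _ _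
  have hC₁' : C₁ ≤ C := by simp only [hC, le_max_iff, le_refl, true_or, or_true]
  have hC₂' : C₂ ≤ C := by simp only [hC, le_max_iff, le_refl, true_or, or_true]
  have hC₃' : C₃ ≤ C := by simp only [hC, le_max_iff, le_refl, true_or, or_true]
  have hC₄' : C₄ ≤ C := by simp only [hC, le_max_iff, le_refl, true_or, or_true]
  have hC₅' : C₅ ≤ C := by simp only [hC, le_max_iff, le_refl, true_or, or_true]
  have hC₆' : C₆ ≤ C := by simp only [hC, le_max_iff, le_refl, true_or, or_true]
  have hC₇' : C₇ ≤ C := by simp only [hC, le_max_iff, le_refl, or_true]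
  have hlip : ∀ z ∈ K, ∀ w ∈ K, ‖(fun z : ℂ => Gamma (1 - z) / Gamma (1 + z)) w -
      (fun z : ℂ => Gamma (1 - z) / Gamma (1 + z)) z‖ ≤ C * ‖w - z‖ := fun z hz w hw =>
    hKconv.norm_image_sub_le_of_norm_deriv_le
      (fun x hx => hR.differentiableAt (hUo.mem_nhds (hKU hx)))
      (fun x hx => (hC₇ x hx).trans hC₇') hz hw
  refine ⟨C, h1, fun z hz => ⟨⟨?_, ?_, ?_, ?_⟩, ?_, ?_, fun w hw => hlip z hz w hw⟩⟩
  · have h := hC₄ z hz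
    simp only [Pi.inv_apply, norm_inv] at h
    exact inv_le_of_inv_le₀ (norm_pos_iff.2 (hm0 z hz)) (h.trans hC₄')
  · exact (hC₃ z hz).trans hC₃'
  · have h := hC₂ z hz
    simp only [Pi.inv_apply, norm_inv] at h
    exact inv_le_of_inv_le₀ (norm_pos_iff.2 (hp0 z hz)) (h.trans hC₂')
  · exact (hC₁ z hz).trans hC₁'
  · have h := hC₆ z hz
    simp only [Pi.inv_apply, norm_inv] at h
    exact inv_le_of_inv_le₀ (norm_pos_iff.2 (hR0 z hz)) (h.trans hC₆')
  · exact (hC₅ z hz).trans hC₅'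

end Summit.Parity.GeneralizedHardyLittlewood.Cruxes.AbsoluteUpgrade.DipMarginRateExchange

end
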